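import Summits.QuantumFields.YangMills.Theorems.LuscherReductionDressedRitzPolyakovLiftChannelUniversality
import Summits.QuantumFields.YangMills.Theorems.LuscherReductionDressedRitzPolyakovLiftShadowPositivity
import HarnessLib

/-!
# Route `LuscherReduction`, item `DressedRitz` (stmt-QuantumFields-20205), line «polyakovlift», stub S-STAT — the SPLIT CERTIFICATE of STATICS:
# (A2) `GramUniversalityAt k` (pure field theory, scale-free) ∧ (o2′) `PScalingGramAt k` (pure one-site, every lift basis) ⟹ the registered r3∕r4 text of `stub_liftStatics`

Fleet-service module of seat ym-infvol-p1 g6 (route `LuscherReduction`, femto rung R2b1; bears on the crux child `DressedRitz` =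
stmt-QuantumFields-20205, skeleton r4 `11e28270fd13c0fc`, stub S-STAT `stub_liftStatics`; `--supports`, helper).  PARALLEL to the lead's split of
S-POS (`…PolyakovLiftUniversality.lean` ∕ `…UniversalityExists.lean` ∕ `…ChannelUniversality.lean`: `ChannelUniversalityAt k ∧ PScalingExistsAt k ⟹
LiftPositionR3`), this module types the split of STATICS and proves its composition.

WHAT IS OPEN IN S-STAT (g5 memo `S-STAT-located.md` rev 5, evidence #50): (o0) is PROVED for every lift basis (`dressedLiftFamily_o0`); (o2)
`|⟨u_i,u_l⟩| ≤ Cλ√n_i√n_l` is PROVED EXACTLY for `S₃`-separated pairs and doublets (`dressedLiftFamily_o2_of_symmetrySeparated ∕ _of_doublet`) and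
OPEN for pairs of channels from two different one-site levels of the same symmetry type — the `O(λ)` universality of the dressed flowed-Polyakov
Gram matrix.  That open content is the SAME field-theoretic comparison «dressed fine channel vectors `u_i = K_β^[L] ins_φ(g_i∘Π_t)` versus their
one-site SHADOWS `w_i = K_B^[L] ins_{e₀}(g_i∘powLink L)`» that S-UNIV makes at Euclidean time 1 ((A5), (A6′)), read at time 0:

* (A2) **`GramUniversalityAt k`** — for every lift basis, all raw vacua, deep in the window, the CORRELATION COEFFICIENTS of the fine dressed family
  and of the one-site shadow family agree to `O(λ)`, in product form
  `|n^f_il · √(n^o_ii n^o_ll) − n^o_il · √(n^f_ii n^f_ll)| ≤ Cλ · √(n^f_ii n^f_ll) · √(n^o_ii n^o_ll)` (`i ≠ l`)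
  — homogeneous of degree 0 under `u ↦ αu` and under `w ↦ γw` SEPARATELY (so it is immune to the scale objection that sank (An) of
  `UniversalityAt`, lead's erratum 2026-08-27T13:33Z: the two families live at the unrelated scales `λ₀^{2L}` and `μ₀(B)^{2L}`);
* (o2′) **`PScalingGramAt k`** — pure ONE-SITE semiclassics in two couplings (`Λ` free, no `β`, no window, exactly the binders of `PScalingDressedAt`
  WITHOUT the relabelling `τ`, since (o2) is symmetric under relabelling and S-STAT is a ∀-basis statement): for EVERY lift basis at `B₁ = 2/Λ³`
  and every one-site raw vacuum at `B = 2L³/Λ³`, the shadow Gram matrix is diagonal to relative `O(Λ)`: `|n^o_il| ≤ CΛ√(n^o_ii)√(n^o_ll)` (`i ≠ l`);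
* ★ **`liftStaticsR3_of_gramUniversality_pscalingGram : (∀ k, GramUniversalityAt k) → (∀ k, PScalingGramAt k) → LiftStaticsR3`**, `LiftStaticsR3` =
  the body of the registered `Stmt.stub_liftStatics` (r3 = r4 text) CHARACTER FOR CHARACTER; constant `C_A + C_B`, level `min lam0_A lam0_B`; the
  shadow norms are positive for every lift basis by `shadowFamily_o0` (p534543), so the product form can be divided through (`o2_transfer`);
* `gram_product_le_of_o2` — the converse POINTWISE inequality: (o2) for the fine family ∧ (o2′) for the shadow ⟹ the (A2) inequality with constant
  `a + b`.  So `(A2) ∧ (o2′) ⟺ (o2) ∧ (o2′)` pointwise: the split LOSES NOTHING and cannot smuggle strength — (A2) is exactly «S-STAT's (o2) modulo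
  the one-site lemma (o2′)», typed in the currency of S-UNIV.

PURPOSE (g5 census item 12, for the LEAD ∕ owner — registry untouched here): with (A2) typed next to (A5)(A6′), «vacuum law + one-step dynamics of the
dressed flowed zero mode vs the one-site shadow, relative `O(λ)`» is ONE field-theoretic deliverable; a later revision may set
`Stmt.stub_universality := ∀ k, ChannelUniversalityAt k ∧ GramUniversalityAt k`, `Stmt.stub_pscaling := … ∧ PScalingGramAt k` and DERIVE
`stub_liftStatics` by this file (lead's pen, owner's word), or keep S-STAT registered with (A2) as its located blueprint.  HONEST FRAMING: typing +
pure-real composition on the CONDITIONAL femto rung R2b1; (A2) is an OPEN renormalisation-group estimate (Bałaban small-field RG to scale `L` +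
zero-mode reduction), (o2′) an OPEN one-site semiclassical estimate (numerically decidable); nothing here bears on infinite volume, the continuum
limit or the Clay gap.  References: M. Lüscher, NPB 219 (1983) 233 [cite: Luscher1983, §3]; M. Lüscher, U. Wolff, NPB 339 (1990) 222
[cite: LuscherWolff1990]; P. van Baal, J. Koller, Ann. Phys. 174 (1987) 299 [cite: KollerVanbaal1986].
-/

set_option autoImplicit false

noncomputable section

open MeasureTheory Filter Topology Real
open Literature.MathematicalPhysics.QuantumFieldTheory (GaugeConfig Site gaugeTransform)
open scoped BigOperators

namespace Summit.QuantumFields.YangMills.Theorems.FemtoTransferGap.PolyakovLift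

open Summit.QuantumFields.YangMills.Theorems.FemtoTransferGap

/-! ## §1 The two typed halves of STATICS -/

/-- **(A2) `GramUniversalityAt k`** — field-theoretic universality of the dressed flowed-Polyakov GRAM MATRIX, scale-free product form: for every
lift basis and all raw vacua, deep in the femto window, the correlation coefficients `n_il/√(n_ii n_ll)` of the fine dressed family
`dressedLiftFamily β φ g` and of its one-site shadow `shadowFamily (oneSiteCoupling β L) L e₀ g` agree to `O(λ)`:
`|n^f_il·√(n^o_ii n^o_ll) − n^o_il·√(n^f_ii n^f_ll)| ≤ Cλ·√(n^f_ii n^f_ll)·√(n^o_ii n^o_ll)` for `i ≠ l`. [cite: Luscher1983, §3] [cite: LuscherWolff1990] -/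
def GramUniversalityAt (k : ℕ) : Prop :=
  ∃ C lam0 : ℝ, 0 ≤ C ∧ 0 < lam0 ∧ ∀ lam : ℝ, 0 < lam → lam ≤ lam0 → ∃ L0 : ℕ,
    ∀ (L : ℕ) [NeZero L], L0 ≤ L → ∀ β : ℝ, InFemtoWindow lam β L →
      ∀ φ : GaugeConfig 3 L SU2 → ℝ, IsRawVacuum β φ →
        ∀ (ω : GaugeConfig 3 1 SU2 → ℝ) (g : Fin k → (GaugeConfig 3 1 SU2 → ℝ)), LiftBasis (liftCoupling β L) k ω g →
          ∀ e₀ : GaugeConfig 3 1 SU2 → ℝ, IsRawVacuum (L := 1) (oneSiteCoupling β L) e₀ →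
            let u := dressedLiftFamily β φ g
            let w := shadowFamily (oneSiteCoupling β L) L e₀ g
            ∀ i l : Fin k, i ≠ l →
              |l2 (u i) (u l) * (Real.sqrt (l2 (w i) (w i)) * Real.sqrt (l2 (w l) (w l))) -
                  l2 (w i) (w l) * (Real.sqrt (l2 (u i) (u i)) * Real.sqrt (l2 (u l) (u l)))|
                ≤ C * luscherLambda β L *
                    (Real.sqrt (l2 (u i) (u i)) * Real.sqrt (l2 (u l) (u l))) *
                      (Real.sqrt (l2 (w i) (w i)) * Real.sqrt (l2 (w l) (w l)))

/-- **(o2′) `PScalingGramAt k`** — the one-site SHADOW Gram matrix is diagonal to relative `O(Λ)`, for EVERY lift basis (pure one-site semiclassics,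
`Λ` free; the binders of `PScalingDressedAt` without the relabelling): for small `Λ`, large `L`, every lift basis `(ω, g)` at `B₁ = 2/Λ³` and every
one-site raw vacuum `e₀` at `B = 2L³/Λ³`, `|⟨w_i, w_l⟩| ≤ CΛ √⟨w_i,w_i⟩ √⟨w_l,w_l⟩` for `i ≠ l`, `w = shadowFamily B L e₀ g`. [cite: Luscher1983, §3] -/
def PScalingGramAt (k : ℕ) : Prop :=
  ∃ C lam0 : ℝ, 0 ≤ C ∧ 0 < lam0 ∧ ∀ lam : ℝ, 0 < lam → lam ≤ lam0 → ∃ L0 : ℕ, ∀ L : ℕ, L0 ≤ L →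
    ∀ Λ : ℝ, lam ≤ Λ → Λ ≤ 2 * lam →
      ∀ (ω : GaugeConfig 3 1 SU2 → ℝ) (g : Fin k → (GaugeConfig 3 1 SU2 → ℝ)), LiftBasis (2 / Λ ^ 3) k ω g →
        ∀ e₀ : GaugeConfig 3 1 SU2 → ℝ, IsRawVacuum (L := 1) (2 * (L : ℝ) ^ 3 / Λ ^ 3) e₀ →
          let w : Fin k → (GaugeConfig 3 1 SU2 → ℝ) := shadowFamily (2 * (L : ℝ) ^ 3 / Λ ^ 3) L e₀ g
          ∀ i l : Fin k, i ≠ l →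
            |l2 (w i) (w l)| ≤ C * Λ * (Real.sqrt (l2 (w i) (w i)) * Real.sqrt (l2 (w l) (w l)))

/-! ## §2 The registered text of S-STAT, re-homed character for character -/

/-- The r3 = r4 text of the registered stub `…Cruxes.DressedRitz.PolyakovLift.Stmt.stub_liftStatics` (skeletons 11209be61e7d2ff5 ∕ 11e28270fd13c0fc),
VERBATIM body (a stub prover re-homes it as `Stmt.stub_liftStatics` and closes it by `liftStaticsR3_of_gramUniversality_pscalingGram`, which carries the
citations).  Deliberately an UNCITED abbreviation of a Summits-side statement text (a cited closed `Prop` would be relocated to `Literature/`, where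
`dressedLiftFamily` does not exist; precedent `LiftPositionR3`). -/
abbrev LiftStaticsR3 : Prop :=
  ∀ k : ℕ, ∃ C lam0 : ℝ, 0 ≤ C ∧ 0 < lam0 ∧ ∀ lam : ℝ, 0 < lam → lam ≤ lam0 → ∃ L0 : ℕ,
    ∀ (L : ℕ) [NeZero L], L0 ≤ L → ∀ β : ℝ, InFemtoWindow lam β L →
      ∀ φ : GaugeConfig 3 L SU2 → ℝ, IsRawVacuum β φ →
        ∀ (ω : GaugeConfig 3 1 SU2 → ℝ) (g : Fin k → (GaugeConfig 3 1 SU2 → ℝ)), LiftBasis (liftCoupling β L) k ω g →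
          StaticClauses k C β (dressedLiftFamily β φ g)

/-! ## §3 Pure-real transfer lemmas -/

/-- (o2) transfer: `|n_f·s_o − n_o·s_f| ≤ a·s_f·s_o` and `|n_o| ≤ b·s_o` with `s_o > 0` give `|n_f| ≤ (a + b)·s_f`. [folklore] -/
theorem o2_transfer {nf no sF sO a b : ℝ} (hsO : 0 < sO) (hsF : 0 ≤ sF)
    (hA : |nf * sO - no * sF| ≤ a * sF * sO) (hB : |no| ≤ b * sO) : |nf| ≤ (a + b) * sF := by
  have h1 : |nf * sO| ≤ a * sF * sO + b * sO * sF := by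
    calc |nf * sO| = |(nf * sO - no * sF) + no * sF| := by ring_nf
      _ ≤ |nf * sO - no * sF| + |no * sF| := abs_add_le _ _
      _ ≤ a * sF * sO + b * sO * sF := by
          rw [abs_mul, abs_of_nonneg hsF]
          exact add_le_add hA (mul_le_mul_of_nonneg_right hB hsF)
  rw [abs_mul, abs_of_pos hsO] at h1
  have h2 : |nf| * sO ≤ ((a + b) * sF) * sO := by
    calc |nf| * sO ≤ a * sF * sO + b * sO * sF := h1
      _ = ((a + b) * sF) * sO := by ring
  exact le_of_mul_le_mul_right h2 hsO

/-- The CONVERSE pointwise inequality: (o2) for the fine numbers (`|n_f| ≤ a·s_f`) and (o2′) for the shadow (`|n_o| ≤ b·s_o`) give the (A2) product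
inequality `|n_f·s_o − n_o·s_f| ≤ (a + b)·s_f·s_o` — the split (A2) ∧ (o2′) is EQUIVALENT to (o2) ∧ (o2′) pointwise; it loses and smuggles nothing. [folklore] -/
theorem gram_product_le_of_o2 {nf no sF sO a b : ℝ} (hsF : 0 ≤ sF) (hsO : 0 ≤ sO)
    (hf : |nf| ≤ a * sF) (ho : |no| ≤ b * sO) : |nf * sO - no * sF| ≤ (a + b) * sF * sO := by
  calc |nf * sO - no * sF| ≤ |nf * sO| + |no * sF| := abs_sub _ _
    _ = |nf| * sO + |no| * sF := by rw [abs_mul, abs_mul, abs_of_nonneg hsO, abs_of_nonneg hsF]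
    _ ≤ a * sF * sO + b * sO * sF := add_le_add (mul_le_mul_of_nonneg_right hf hsO) (mul_le_mul_of_nonneg_right ho hsF)
    _ = (a + b) * sF * sO := by ring

/-! ## §4 ★ The composition: (A2) ∧ (o2′) ⟹ the registered r3∕r4 text of S-STAT -/

/-- ★★ **`GramUniversalityAt` (all levels) ∧ `PScalingGramAt` (all levels) ⟹ `Stmt.stub_liftStatics` (r3 = r4 text)**: (o0) is the tree's
`dressedLiftFamily_o0`; for (o2) take the one-site Perron–Frobenius vacuum `e₀` at `B = oneSiteCoupling β L` (`PhysL2.exists_groundState`), read (A2)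
and (o2′) at `Λ = λ(β,L)` (`lam ≤ λ ≤ 2 lam` in the window) for the GIVEN lift basis, note that the shadow norms are positive (`shadowFamily_o0`), and
divide the product form through (`o2_transfer`); constant `C_A + C_B`, level `min lam0_A lam0_B`. [cite: Luscher1983, §3] [cite: LuscherWolff1990] -/
theorem liftStaticsR3_of_gramUniversality_pscalingGram (hA : ∀ k, GramUniversalityAt k) (hB : ∀ k, PScalingGramAt k) :
    LiftStaticsR3 := by
  intro k
  obtain ⟨CA, lA, hCA, hlA, hAk⟩ := hA k
  obtain ⟨CB, lB, hCB, hlB, hBk⟩ := hB k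
  refine ⟨CA + CB, min lA lB, by positivity, lt_min hlA hlB, fun lam hlam hle => ?_⟩
  obtain ⟨LA, hLA⟩ := hAk lam hlam (hle.trans (min_le_left _ _))
  obtain ⟨LB, hLB⟩ := hBk lam hlam (hle.trans (min_le_right _ _))
  refine ⟨max LA LB, fun L _ hL β hW φ hφ ω g hbasis => ?_⟩
  have hleA : LA ≤ L := (le_max_left _ _).trans hL
  have hleB : LB ≤ L := (le_max_right _ _).trans hL
  have hΛpos : 0 < luscherLambda β L := luscherLambda_pos_of_window hlam hW
  have hLpos' : 0 < L := NeZero.pos L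
  have hLpos : (0 : ℝ) < L := Nat.cast_pos.mpr hLpos'
  have hB1pos : 0 < liftCoupling β L := by unfold liftCoupling; exact div_pos two_pos (pow_pos hΛpos 3)
  have hBpos : 0 < oneSiteCoupling β L := by
    unfold oneSiteCoupling; exact div_pos (mul_pos two_pos (pow_pos hLpos 3)) (pow_pos hΛpos 3)
  refine ⟨dressedLiftFamily_o0 hlam hW hφ hbasis, fun i l hil => ?_⟩
  -- the one-site Perron–Frobenius vacuum at `B = oneSiteCoupling β L`
  obtain ⟨e₀, θ, c, he₀, -, -, hn₀, heig₀, -, -, -⟩ := PhysL2.exists_groundState (L := 1) (oneSiteCoupling β L)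
  have heig₀' : transferApply (oneSiteCoupling β L) e₀ = levelValue su2Rep 1 (oneSiteCoupling β L) 0 • e₀ := by
    rw [levelValue_zero]; exact heig₀
  have hvac₀ : IsRawVacuum (L := 1) (oneSiteCoupling β L) e₀ := ⟨he₀, hn₀, heig₀'⟩
  -- shadow norms are positive for every lift basis
  have hw0 := shadowFamily_o0 (L := L) hBpos hB1pos hLpos' hvac₀ hbasis
  set u := dressedLiftFamily β φ g with hu
  set w := shadowFamily (oneSiteCoupling β L) L e₀ g with hw
  -- (A2) for the given basis and (o2′) at `Λ = λ(β,L)` (`oneSiteCoupling β L = 2L³/λ³` by definition)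
  have hA2' : |l2 (u i) (u l) * (Real.sqrt (l2 (w i) (w i)) * Real.sqrt (l2 (w l) (w l))) -
      l2 (w i) (w l) * (Real.sqrt (l2 (u i) (u i)) * Real.sqrt (l2 (u l) (u l)))|
        ≤ CA * luscherLambda β L * (Real.sqrt (l2 (u i) (u i)) * Real.sqrt (l2 (u l) (u l))) *
            (Real.sqrt (l2 (w i) (w i)) * Real.sqrt (l2 (w l) (w l))) :=
    hLA L hleA β hW φ hφ ω g hbasis e₀ hvac₀ i l hil
  have hB2' : |l2 (w i) (w l)| ≤ CB * luscherLambda β L * (Real.sqrt (l2 (w i) (w i)) * Real.sqrt (l2 (w l) (w l))) :=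
    hLB L hleB (luscherLambda β L) hW.2.1 hW.2.2 ω g hbasis e₀ hvac₀ i l hil
  have hsO : 0 < Real.sqrt (l2 (w i) (w i)) * Real.sqrt (l2 (w l) (w l)) :=
    mul_pos (Real.sqrt_pos.mpr (hw0 i)) (Real.sqrt_pos.mpr (hw0 l))
  have hsF : 0 ≤ Real.sqrt (l2 (u i) (u i)) * Real.sqrt (l2 (u l) (u l)) := mul_nonneg (Real.sqrt_nonneg _) (Real.sqrt_nonneg _)
  have h := o2_transfer hsO hsF hA2' hB2'
  calc |l2 (u i) (u l)| ≤ (CA * luscherLambda β L + CB * luscherLambda β L) *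
        (Real.sqrt (l2 (u i) (u i)) * Real.sqrt (l2 (u l) (u l))) := h
    _ = (CA + CB) * luscherLambda β L * (Real.sqrt (l2 (u i) (u i)) * Real.sqrt (l2 (u l) (u l))) := by ring

/-- The same composition with the conclusion spelled as the (o2)-ONLY family of `dressed_stub_liftStatics_of_o2` (`…StaticsDressedResidual.lean`):
(A2) ∧ (o2′) give, at every level, the off-diagonal clause of `StaticClauses` for every lift basis. [cite: Luscher1983, §3] -/
theorem dressedLiftFamily_o2_of_gramUniversality_pscalingGram (hA : ∀ k, GramUniversalityAt k) (hB : ∀ k, PScalingGramAt k) :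
    ∀ k : ℕ, ∃ C lam0 : ℝ, 0 ≤ C ∧ 0 < lam0 ∧ ∀ lam : ℝ, 0 < lam → lam ≤ lam0 → ∃ L0 : ℕ,
      ∀ (L : ℕ) [NeZero L], L0 ≤ L → ∀ β : ℝ, InFemtoWindow lam β L →
        ∀ φ : GaugeConfig 3 L SU2 → ℝ, IsRawVacuum β φ →
          ∀ (ω : GaugeConfig 3 1 SU2 → ℝ) (g : Fin k → (GaugeConfig 3 1 SU2 → ℝ)), LiftBasis (liftCoupling β L) k ω g →
            ∀ i l : Fin k, i ≠ l →
              |l2 (dressedLiftFamily β φ g i) (dressedLiftFamily β φ g l)| ≤ C * luscherLambda β L *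
                (Real.sqrt (l2 (dressedLiftFamily β φ g i) (dressedLiftFamily β φ g i)) *
                  Real.sqrt (l2 (dressedLiftFamily β φ g l) (dressedLiftFamily β φ g l))) := by
  intro k
  obtain ⟨C, lam0, hC, hlam0, h⟩ := liftStaticsR3_of_gramUniversality_pscalingGram hA hB k
  refine ⟨C, lam0, hC, hlam0, fun lam hlam hle => ?_⟩
  obtain ⟨L0, hL0⟩ := h lam hlam hle
  exact ⟨L0, fun L _ hL β hW φ hvac ω g hbasis => (hL0 L hL β hW φ hvac ω g hbasis).2⟩

end Summit.QuantumFields.YangMills.Theorems.FemtoTransferGap.PolyakovLift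

end
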